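import Summits.QuantumFields.YangMills.Theorems.HyperbolicRegulatorCurvatureAnchorRDefs
import Summits.QuantumFields.YangMills.Theorems.HyperbolicRegulatorHyperbolicToTorusDefs

/-!
# Route `HyperbolicRegulator`, crux `CurvatureAnchorR` (stmt-QuantumFields-18155), line `witten_hessian`:
# helpers for the registered stub `stub_instantiate` (measure-theoretic interface)

Helper file (lead `prover-line-stmt-QuantumFields-18155-0`, stub worker for `stub_instantiate`).  Nothing is asserted about
the route; the file collects the small `G`-free and measure-theoretic lemmas consumed by
`Theorems/HyperbolicRegulatorCurvatureAnchorRStubInstantiate.lean`: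

* §1 the CHART WALK of the repaired admissibility predicate `AdmR` (byte-identical to the disprover's
  `Cruxes.CurvatureAnchor.Disproof.AdmR`): a chart point `cV x a` with `a` in the box of sup-radius `⌊k/4⌋` lies within
  graph distance `|a.1| + |a.2|` of the C′-flat centre `x` (`AdmR.chart_dist_le`), and the edge read by the chart at `a`
  in direction `μ` has both endpoints within `|a.1| + |a.2| + 1` of `x` (`AdmR.chart_edge_near`) — adapted from
  `Cruxes/CurvatureAnchor/Disproof.lean` (refuter-cdisprove-15826), which is not importable from `Theorems/`;
* §2 the ℕ-division bookkeeping for support radius `⌊k/8⌋` inside charts of radius `⌊k/4⌋` read at flat distance `⌊k/2⌋`;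
* §3 generic bounds for a Gibbs RATIO `X h = (∫ h ρ dν) / (∫ ρ dν)` with a non-negative integrable density of positive
  total mass: `|X h| ≤ ‖h‖∞` and `|X (f g) − X f · X g| ≤ 2 ‖f‖∞ ‖g‖∞`, plus the monotonicity of an exponential clustering
  bound in its constant;
* §4 the configuration space `(↥PE → G)` of a compact group carrying a faithful continuous matrix representation: second
  countability of `G`, continuity / measurability of the oriented link variable `U ↦ U(l)^{±1}`.

All statements are folklore; no published theorem is restated.
-/

set_option autoImplicit false

noncomputable section

namespace Summit.QuantumFields.YangMills.Cruxes.CurvatureAnchorR.WittenHessian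

open scoped BigOperators Topology Classical MeasureTheory
open MeasureTheory
open Literature.MathematicalPhysics.QuantumFieldTheory Literature.MathematicalPhysics.QuantumLattice
open Summit.QuantumFields.YangMills.Cruxes.HyperbolicToTorus.NoAdmissibleComplex (graphOf conesOf InBox)

/-! ## §1 The chart walk of `AdmR` (adapted from `Cruxes/CurvatureAnchor/Disproof.lean`, refuter-cdisprove-15826) -/

section ChartWalk

variable {k j : ℕ} {V E Q : Finset ℕ} {σ τ : ℕ → ℕ} {bd : ℕ → Fin 4 → ℕ × Bool} {cV : ℕ → ℤ × ℤ → ℕ}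
  {cE : ℕ → ℤ × ℤ → Fin 2 → ℕ × Bool}

-- adapted from Cruxes/CurvatureAnchor/Disproof.lean (refuter-cdisprove-15826)
/-- The chart clause of `AdmR` at a C′-flat vertex `x` (definitional unfolding of clause 9). -/
theorem AdmR.chart (hA : AdmR k j V E Q σ τ bd cV cE) {x : ℕ}
    (hx : x ∈ V ∧ ∀ c ∈ conesOf V E σ τ, k / 2 < (graphOf E σ τ).dist x c) :
    cV x (0, 0) = x ∧ (∀ a : ℤ × ℤ, InBox ((k : ℤ) / 4) a → cV x a ∈ V) ∧
      Set.InjOn (cV x) {a | InBox ((k : ℤ) / 4) a} ∧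
      (∀ (a : ℤ × ℤ) (μ : Fin 2), InBox ((k : ℤ) / 4) a →
        InBox ((k : ℤ) / 4) (if μ = 0 then (a.1 + 1, a.2) else (a.1, a.2 + 1)) →
          (cE x a μ).1 ∈ E ∧
          (if (cE x a μ).2 then σ (cE x a μ).1 else τ (cE x a μ).1) = cV x a ∧
          (if (cE x a μ).2 then τ (cE x a μ).1 else σ (cE x a μ).1) =
            cV x (if μ = 0 then (a.1 + 1, a.2) else (a.1, a.2 + 1))) := by
  obtain ⟨-, -, -, -, -, -, -, -, h9⟩ := hA
  obtain ⟨h0, hmem, hinj, hedge, -⟩ := h9 x hx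
  exact ⟨h0, hmem, hinj, hedge⟩

-- adapted from Cruxes/CurvatureAnchor/Disproof.lean (refuter-cdisprove-15826)
/-- One chart step is a `Γ`-edge: `cV x a ~ cV x (a + e_μ)` whenever both points are in the box (clause 9d gives the
edge, injectivity 9c makes its endpoints distinct). -/
theorem AdmR.chart_adj (hA : AdmR k j V E Q σ τ bd cV cE) {x : ℕ}
    (hx : x ∈ V ∧ ∀ c ∈ conesOf V E σ τ, k / 2 < (graphOf E σ τ).dist x c)
    (a : ℤ × ℤ) (μ : Fin 2) (ha : InBox ((k : ℤ) / 4) a)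
    (hb : InBox ((k : ℤ) / 4) (if μ = 0 then (a.1 + 1, a.2) else (a.1, a.2 + 1))) :
    (graphOf E σ τ).Adj (cV x a) (cV x (if μ = 0 then (a.1 + 1, a.2) else (a.1, a.2 + 1))) := by
  obtain ⟨-, -, hinj, hedge⟩ := hA.chart hx
  obtain ⟨hE, hst, hen⟩ := hedge a μ ha hb
  have hne : cV x a ≠ cV x (if μ = 0 then (a.1 + 1, a.2) else (a.1, a.2 + 1)) := by
    intro h
    have := hinj ha hb h
    fin_cases μ <;> simp [Prod.ext_iff] at this
  rw [graphOf, SimpleGraph.fromRel_adj]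
  refine ⟨hne, ?_⟩
  by_cases h2 : (cE x a μ).2 = true
  · left
    simp only [h2, if_true] at hst hen
    exact ⟨(cE x a μ).1, hE, hst, hen⟩
  · right
    simp only [h2] at hst hen
    exact ⟨(cE x a μ).1, hE, hen, hst⟩

-- adapted from Cruxes/CurvatureAnchor/Disproof.lean (refuter-cdisprove-15826)
/-- Box bookkeeping (pure arithmetic): every non-zero box point has a box neighbour one step closer to the origin in
`ℓ¹`, related to it by a unit chart step in one of the two orders. -/
theorem exists_box_pred {R : ℤ} {a : ℤ × ℤ} (ha : InBox R a) (h0 : a ≠ (0, 0)) :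
    ∃ a' : ℤ × ℤ, InBox R a' ∧ |a'.1| + |a'.2| + 1 = |a.1| + |a.2| ∧
      ∃ μ : Fin 2, a = (if μ = 0 then (a'.1 + 1, a'.2) else (a'.1, a'.2 + 1)) ∨
        a' = (if μ = 0 then (a.1 + 1, a.2) else (a.1, a.2 + 1)) := by
  obtain ⟨x, y⟩ := a
  obtain ⟨h1, h2⟩ := ha
  change |x| ≤ R at h1
  change |y| ≤ R at h2
  rw [abs_le] at h1 h2
  rcases lt_trichotomy x 0 with hx | rfl | hx
  · refine ⟨(x + 1, y), ⟨?_, ?_⟩, ?_, 0, Or.inr ?_⟩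
    · show |x + 1| ≤ R
      rw [abs_le]; omega
    · show |y| ≤ R
      rw [abs_le]; omega
    · show |x + 1| + |y| + 1 = |x| + |y|
      rw [abs_of_neg hx, abs_of_nonpos (by omega : x + 1 ≤ 0)]; ring
    · rw [if_pos rfl]
  · rcases lt_trichotomy y 0 with hy | rfl | hy
    · refine ⟨(0, y + 1), ⟨?_, ?_⟩, ?_, 1, Or.inr ?_⟩
      · show |(0 : ℤ)| ≤ R
        rw [abs_le]; omega
      · show |y + 1| ≤ R
        rw [abs_le]; omega
      · show |(0 : ℤ)| + |y + 1| + 1 = |(0 : ℤ)| + |y|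
        rw [abs_of_neg hy, abs_of_nonpos (by omega : y + 1 ≤ 0)]; ring
      · rw [if_neg (by decide)]
    · exact absurd rfl h0
    · refine ⟨(0, y - 1), ⟨?_, ?_⟩, ?_, 1, Or.inl ?_⟩
      · show |(0 : ℤ)| ≤ R
        rw [abs_le]; omega
      · show |y - 1| ≤ R
        rw [abs_le]; omega
      · show |(0 : ℤ)| + |y - 1| + 1 = |(0 : ℤ)| + |y|
        rw [abs_of_pos hy, abs_of_nonneg (by omega : (0 : ℤ) ≤ y - 1)]; ring
      · rw [if_neg (by decide)]
        simp
  · refine ⟨(x - 1, y), ⟨?_, ?_⟩, ?_, 0, Or.inl ?_⟩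
    · show |x - 1| ≤ R
      rw [abs_le]; omega
    · show |y| ≤ R
      rw [abs_le]; omega
    · show |x - 1| + |y| + 1 = |x| + |y|
      rw [abs_of_pos hx, abs_of_nonneg (by omega : (0 : ℤ) ≤ x - 1)]; ring
    · rw [if_pos rfl]
      simp

-- adapted from Cruxes/CurvatureAnchor/Disproof.lean (refuter-cdisprove-15826)
/-- Chart points are reached from the centre by a walk along chart edges of length `≤ |a.1| + |a.2|`. -/
theorem AdmR.chart_walk (hA : AdmR k j V E Q σ τ bd cV cE) {x : ℕ}
    (hx : x ∈ V ∧ ∀ c ∈ conesOf V E σ τ, k / 2 < (graphOf E σ τ).dist x c) :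
    ∀ (n : ℕ) (a : ℤ × ℤ), InBox ((k : ℤ) / 4) a → |a.1| + |a.2| ≤ n →
      ∃ p : (graphOf E σ τ).Walk x (cV x a), p.length ≤ n := by
  intro n
  induction n with
  | zero =>
    intro a ha hn
    have ha1 := abs_nonneg a.1
    have ha2 := abs_nonneg a.2
    have h1 : a.1 = 0 := abs_eq_zero.mp (by push_cast at hn; omega)
    have h2 : a.2 = 0 := abs_eq_zero.mp (by push_cast at hn; omega)
    obtain ⟨a1, a2⟩ := a
    change a1 = 0 at h1
    change a2 = 0 at h2
    subst h1
    subst h2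
    exact ⟨SimpleGraph.Walk.nil.copy rfl (hA.chart hx).1.symm, by simp⟩
  | succ n ih =>
    intro a ha hn
    by_cases h0 : a = (0, 0)
    · subst h0
      exact ⟨SimpleGraph.Walk.nil.copy rfl (hA.chart hx).1.symm, by simp⟩
    obtain ⟨a', ha', hnorm, μ, hstep⟩ := exists_box_pred ha h0
    obtain ⟨p, hp⟩ := ih a' ha' (by push_cast at hn ⊢; omega)
    have hadj : (graphOf E σ τ).Adj (cV x a') (cV x a) := by
      rcases hstep with h | h
      · have h' := hA.chart_adj hx a' μ ha' (by rw [← h]; exact ha)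
        rw [← h] at h'
        exact h'
      · have h' := hA.chart_adj hx a μ ha (by rw [← h]; exact ha')
        rw [← h] at h'
        exact h'.symm
    exact ⟨p.concat hadj, by rw [SimpleGraph.Walk.length_concat]; omega⟩

-- adapted from Cruxes/CurvatureAnchor/Disproof.lean (refuter-cdisprove-15826)
/-- Hence chart points are within graph distance `|a.1| + |a.2|` of the centre. -/
theorem AdmR.chart_dist_le (hA : AdmR k j V E Q σ τ bd cV cE) {x : ℕ}
    (hx : x ∈ V ∧ ∀ c ∈ conesOf V E σ τ, k / 2 < (graphOf E σ τ).dist x c)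
    (n : ℕ) (a : ℤ × ℤ) (ha : InBox ((k : ℤ) / 4) a) (hn : |a.1| + |a.2| ≤ n) :
    (graphOf E σ τ).dist x (cV x a) ≤ n := by
  obtain ⟨p, hp⟩ := hA.chart_walk hx n a ha hn
  exact (SimpleGraph.dist_le p).trans hp

/-- **The edge read by a chart is near its centre**: for `a` and `a + e_μ` in the box and `|a.1| + |a.2| + 1 ≤ n`, the
edge `(cE x a μ).1` lies in `E` and both of its endpoints `σ`, `τ` are within graph distance `n` of the C′-flat centre
`x` (its endpoints are `cV x a` and `cV x (a + e_μ)` in some order, by clause 9d). -/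
theorem AdmR.chart_edge_near (hA : AdmR k j V E Q σ τ bd cV cE) {x : ℕ}
    (hx : x ∈ V ∧ ∀ c ∈ conesOf V E σ τ, k / 2 < (graphOf E σ τ).dist x c)
    (n : ℕ) (a : ℤ × ℤ) (μ : Fin 2) (ha : InBox ((k : ℤ) / 4) a)
    (hb : InBox ((k : ℤ) / 4) (if μ = 0 then (a.1 + 1, a.2) else (a.1, a.2 + 1)))
    (hn : |a.1| + |a.2| + 1 ≤ n) :
    (cE x a μ).1 ∈ E ∧ (graphOf E σ τ).dist x (σ (cE x a μ).1) ≤ n ∧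
      (graphOf E σ τ).dist x (τ (cE x a μ).1) ≤ n := by
  obtain ⟨-, -, -, hedge⟩ := hA.chart hx
  obtain ⟨hE, hst, hen⟩ := hedge a μ ha hb
  have h1 : (graphOf E σ τ).dist x (cV x a) ≤ n :=
    hA.chart_dist_le hx n a ha (by omega)
  have h2 : (graphOf E σ τ).dist x (cV x (if μ = 0 then (a.1 + 1, a.2) else (a.1, a.2 + 1))) ≤ n := by
    refine hA.chart_dist_le hx n _ hb ?_
    have ha1 := abs_nonneg a.1
    have ha2 := abs_nonneg a.2
    fin_cases μ
    · simp only [Fin.zero_eta, Fin.isValue, ↓reduceIte]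
      calc |a.1 + 1| + |a.2| ≤ (|a.1| + |1|) + |a.2| := by gcongr; exact abs_add_le _ _
        _ = |a.1| + |a.2| + 1 := by rw [abs_one]; ring
        _ ≤ n := hn
    · simp only [Fin.mk_one, Fin.isValue, one_ne_zero, ↓reduceIte]
      calc |a.1| + |a.2 + 1| ≤ |a.1| + (|a.2| + |1|) := by gcongr; exact abs_add_le _ _
        _ = |a.1| + |a.2| + 1 := by rw [abs_one]; ring
        _ ≤ n := hn
  refine ⟨hE, ?_, ?_⟩
  · by_cases hs : (cE x a μ).2 = true
    · simp only [hs, if_true] at hst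
      rw [hst]; exact h1
    · simp only [hs] at hen
      simp only [Bool.false_eq_true, ↓reduceIte] at hen
      rw [hen]; exact h2
  · by_cases hs : (cE x a μ).2 = true
    · simp only [hs, if_true] at hen
      rw [hen]; exact h2
    · simp only [hs] at hst
      simp only [Bool.false_eq_true, ↓reduceIte] at hst
      rw [hst]; exact h1

end ChartWalk

/-! ## §2 Arithmetic of the support radius -/

/-- ℕ-division bookkeeping for `8 ≤ k`: an observable of support radius `⌊k/8⌋` is read inside the chart box
(`⌊k/8⌋ + 1 ≤ ⌊k/4⌋`) and within flat distance of the base point (`2⌊k/8⌋ + 1 ≤ ⌊k/2⌋`); also `0 < k`. -/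
theorem support_arith (k : ℕ) (hk : 8 ≤ k) :
    ((k / 8 : ℕ) : ℤ) + 1 ≤ (k : ℤ) / 4 ∧ 2 * (k / 8) + 1 ≤ k / 2 ∧ 0 < k := by
  omega


/-- One chart step stays in the box when there is a margin of one. -/
theorem inBox_step {R : ℤ} {a : ℤ × ℤ} (h1 : |a.1| + 1 ≤ R) (h2 : |a.2| + 1 ≤ R) (μ : Fin 2) :
    InBox R (if μ = 0 then (a.1 + 1, a.2) else (a.1, a.2 + 1)) := by
  have e1 := abs_le.mp (show |a.1| ≤ R - 1 by linarith)
  have e2 := abs_le.mp (show |a.2| ≤ R - 1 by linarith)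
  by_cases hμ : μ = 0
  · rw [if_pos hμ]
    constructor
    · show |a.1 + 1| ≤ R
      rw [abs_le]; omega
    · show |a.2| ≤ R
      rw [abs_le]; omega
  · rw [if_neg hμ]
    constructor
    · show |a.1| ≤ R
      rw [abs_le]; omega
    · show |a.2 + 1| ≤ R
      rw [abs_le]; omega

/-- The rate bookkeeping of the NEAR case: `(c/k)·d ≤ 2c` when `d ≤ 2k`. -/
theorem rate_near {c : ℝ} {k d : ℕ} (hc : 0 ≤ c) (hk : 0 < k) (hd : d ≤ 2 * k) :
    c / k * (d : ℝ) ≤ 2 * c := by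
  have hk' : (0 : ℝ) < k := Nat.cast_pos.mpr hk
  have hd' : (d : ℝ) ≤ 2 * k := by exact_mod_cast hd
  calc c / k * d ≤ c / k * (2 * k) := mul_le_mul_of_nonneg_left hd' (div_nonneg hc hk'.le)
    _ = 2 * c := by field_simp

/-- The constant bookkeeping of the FAR case: `K ≤ (max K 0 + 2)·e^{2c}`. -/
theorem far_const_le {Kc MA MB c e : ℝ} (hMA : 0 ≤ MA) (hMB : 0 ≤ MB) (he : 0 ≤ e) (hc : 0 ≤ c) :
    Kc * MA * MB * e ≤ (max Kc 0 + 2) * MA * MB * Real.exp (2 * c) * e := by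
  have h0 : Kc ≤ max Kc 0 := le_max_left Kc 0
  have h0' : 0 ≤ max Kc 0 := le_max_right Kc 0
  have h2 : (1 : ℝ) ≤ Real.exp (2 * c) := Real.one_le_exp (by linarith)
  have h1 : Kc ≤ (max Kc 0 + 2) * Real.exp (2 * c) := by nlinarith
  calc Kc * MA * MB * e = Kc * (MA * MB * e) := by ring
    _ ≤ ((max Kc 0 + 2) * Real.exp (2 * c)) * (MA * MB * e) :=
        mul_le_mul_of_nonneg_right h1 (by positivity)
    _ = (max Kc 0 + 2) * MA * MB * Real.exp (2 * c) * e := by ring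

/-- The constant bookkeeping of the NEAR case: `2 ≤ (max K 0 + 2)·e^{2c}·e^{−t}` when `t ≤ 2c`. -/
theorem near_const_le {Kc MA MB c t : ℝ} (hMA : 0 ≤ MA) (hMB : 0 ≤ MB) (ht : t ≤ 2 * c) :
    2 * MA * MB ≤ (max Kc 0 + 2) * MA * MB * Real.exp (2 * c) * Real.exp (-t) := by
  have h1 : (1 : ℝ) ≤ Real.exp (2 * c) * Real.exp (-t) := by
    rw [← Real.exp_add]
    exact Real.one_le_exp (by linarith)
  have h2 : (2 : ℝ) ≤ max Kc 0 + 2 := by linarith [le_max_right Kc 0]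
  calc 2 * MA * MB = 2 * (MA * MB) * 1 := by ring
    _ ≤ (max Kc 0 + 2) * (MA * MB) * (Real.exp (2 * c) * Real.exp (-t)) :=
        mul_le_mul (mul_le_mul_of_nonneg_right h2 (by positivity)) h1 zero_le_one (by positivity)
    _ = (max Kc 0 + 2) * MA * MB * Real.exp (2 * c) * Real.exp (-t) := by ring

/-! ## §3 Gibbs ratios with a non-negative density -/

section Gibbs

variable {Ω : Type*} [MeasurableSpace Ω] {ν : Measure Ω} {ρ : Ω → ℝ}

/-- `|∫ h ρ dν| ≤ ‖h‖∞ · ∫ ρ dν` for a non-negative integrable density `ρ`. -/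
theorem abs_integral_mul_density_le (hρ0 : ∀ U, 0 ≤ ρ U) (hρi : Integrable ρ ν) {h : Ω → ℝ} {M : ℝ}
    (hb : ∀ U, |h U| ≤ M) : |∫ U, h U * ρ U ∂ν| ≤ M * ∫ U, ρ U ∂ν := by
  have h1 : ∀ᵐ U ∂ν, ‖h U * ρ U‖ ≤ M * ρ U := Filter.Eventually.of_forall fun U => by
    rw [Real.norm_eq_abs, abs_mul, abs_of_nonneg (hρ0 U)]
    exact mul_le_mul_of_nonneg_right (hb U) (hρ0 U)
  have h2 := norm_integral_le_of_norm_le (hρi.const_mul M) h1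
  rwa [Real.norm_eq_abs, integral_const_mul] at h2

/-- The Gibbs ratio of a bounded function is bounded by the same constant: `|X h| ≤ ‖h‖∞` for
`X h = (∫ h ρ dν) / (∫ ρ dν)` with `∫ ρ dν > 0`. -/
theorem abs_gibbsRatio_le (hρ0 : ∀ U, 0 ≤ ρ U) (hρi : Integrable ρ ν) (hZ : 0 < ∫ U, ρ U ∂ν)
    {h : Ω → ℝ} {M : ℝ} (hb : ∀ U, |h U| ≤ M) :
    |(∫ U, h U * ρ U ∂ν) / (∫ U, ρ U ∂ν)| ≤ M := by
  rw [abs_div, abs_of_pos hZ, div_le_iff₀ hZ]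
  exact abs_integral_mul_density_le hρ0 hρi hb

/-- The trivial covariance bound of a Gibbs ratio: `|X (f g) − X f · X g| ≤ 2 ‖f‖∞ ‖g‖∞`. -/
theorem abs_gibbsCov_le (hρ0 : ∀ U, 0 ≤ ρ U) (hρi : Integrable ρ ν) (hZ : 0 < ∫ U, ρ U ∂ν)
    {f g : Ω → ℝ} {Mf Mg : ℝ} (hf : ∀ U, |f U| ≤ Mf) (hg : ∀ U, |g U| ≤ Mg) (hMf : 0 ≤ Mf) :
    |(∫ U, (f U * g U) * ρ U ∂ν) / (∫ U, ρ U ∂ν) -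
        (∫ U, f U * ρ U ∂ν) / (∫ U, ρ U ∂ν) * ((∫ U, g U * ρ U ∂ν) / (∫ U, ρ U ∂ν))| ≤
      2 * Mf * Mg := by
  have hfg : ∀ U, |f U * g U| ≤ Mf * Mg := fun U => by
    rw [abs_mul]; exact mul_le_mul (hf U) (hg U) (abs_nonneg _) hMf
  have h1 := abs_gibbsRatio_le hρ0 hρi hZ hfg
  have h2 := abs_gibbsRatio_le hρ0 hρi hZ hf
  have h3 := abs_gibbsRatio_le hρ0 hρi hZ hg
  calc _ ≤ |(∫ U, (f U * g U) * ρ U ∂ν) / (∫ U, ρ U ∂ν)| +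
        |(∫ U, f U * ρ U ∂ν) / (∫ U, ρ U ∂ν) * ((∫ U, g U * ρ U ∂ν) / (∫ U, ρ U ∂ν))| := abs_sub _ _
    _ ≤ Mf * Mg + Mf * Mg := by
        rw [abs_mul]
        exact add_le_add h1 (mul_le_mul h2 h3 (abs_nonneg _) hMf)
    _ = 2 * Mf * Mg := by ring

/-- A continuous real function on a compact configuration space, integrated against a finite measure for which
continuous functions are measurable, is an admissible density: `U ↦ exp (β S U)` is non-negative, integrable, and of
positive total mass when the measure is non-zero. -/
theorem density_exp_admissible [TopologicalSpace Ω] [CompactSpace Ω] [OpensMeasurableSpace Ω]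
    [IsFiniteMeasure ν] [NeZero ν] {S : Ω → ℝ} (hS : Continuous S) (β : ℝ) :
    (∀ U, 0 ≤ Real.exp (β * S U)) ∧ Integrable (fun U => Real.exp (β * S U)) ν ∧
      0 < ∫ U, Real.exp (β * S U) ∂ν := by
  have hc : Continuous fun U => Real.exp (β * S U) := Real.continuous_exp.comp (continuous_const.mul hS)
  obtain ⟨C, hC⟩ := isCompact_univ.exists_bound_of_continuousOn hc.continuousOn
  have hi : Integrable (fun U => Real.exp (β * S U)) ν :=
    (integrable_const C).mono' hc.measurable.aestronglyMeasurable
      (Filter.Eventually.of_forall fun U => hC U (Set.mem_univ U))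
  exact ⟨fun U => (Real.exp_pos _).le, hi, integral_exp_pos hi⟩

end Gibbs

/-! ## §4 The configuration space of a linear compact group -/

section Config

variable {G : Type*} [Group G]

/-- A compact group with a faithful continuous matrix representation is second countable (the representation is a
closed embedding into a second countable space). -/
theorem secondCountable_of_latticeRep [TopologicalSpace G] [CompactSpace G] (r : LatticeRep G) :
    SecondCountableTopology G :=
  (r.continuous.isClosedEmbedding r.injective).isEmbedding.secondCountableTopology

/-- The oriented link variable `U ↦ U(l)^{±1}` (and `1` off the edge set) is continuous on the configuration space
`↥PE → G` (decidability instances are taken from the goal). -/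
theorem continuous_linkVar [TopologicalSpace G] [ContinuousInv G] {Ed : Type*} (PE : Finset Ed) (e : Ed × Bool)
    {d₁ : Decidable (e.1 ∈ PE)} {d₂ : Decidable (e.2 = true)} :
    Continuous fun U : (↥PE → G) =>
      @dite G (e.1 ∈ PE) d₁ (fun h => @ite G (e.2 = true) d₂ (U ⟨e.1, h⟩) (U ⟨e.1, h⟩)⁻¹) (fun _ => 1) := by
  by_cases h : e.1 ∈ PE
  · simp only [dif_pos h]
    by_cases h2 : e.2 = true
    · simp only [if_pos h2]
      exact continuous_apply _
    · simp only [if_neg h2]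
      exact (continuous_apply _).inv
  · simp only [dif_neg h]
    exact continuous_const

/-- The oriented link variable is measurable on the configuration space `↥PE → G` with its product σ-algebra
(decidability instances are taken from the goal). -/
theorem measurable_linkVar [MeasurableSpace G] [MeasurableInv G] {Ed : Type*} (PE : Finset Ed) (e : Ed × Bool)
    {d₁ : Decidable (e.1 ∈ PE)} {d₂ : Decidable (e.2 = true)} :
    Measurable fun U : (↥PE → G) =>
      @dite G (e.1 ∈ PE) d₁ (fun h => @ite G (e.2 = true) d₂ (U ⟨e.1, h⟩) (U ⟨e.1, h⟩)⁻¹) (fun _ => 1) := by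
  by_cases h : e.1 ∈ PE
  · simp only [dif_pos h]
    by_cases h2 : e.2 = true
    · simp only [if_pos h2]
      exact measurable_pi_apply _
    · simp only [if_neg h2]
      exact (measurable_pi_apply _).inv
  · simp only [dif_neg h]
    exact measurable_const

/-- `g ↦ Re tr r(g)` is continuous. -/
theorem continuous_trace_re_rep [TopologicalSpace G] (r : LatticeRep G) : Continuous fun g : G => (r.ρ g).trace.re :=
  Complex.continuous_re.comp r.continuous.matrix_trace

end Config

end Summit.QuantumFields.YangMills.Cruxes.CurvatureAnchorR.WittenHessian

end
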